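import Summits.SmoothPoincare4.SmoothPoincare4.Theorems.SymplecticOrigamiGromovRecognitionRelEndOrientationSign
import Summits.SmoothPoincare4.SmoothPoincare4.Theorems.SymplecticOrigamiGromovRecognitionRelEndGlueDefs
import Mathlib.Topology.Connected.Basic

/-!
# Constancy of the orientation sign along an embedded sphere
(registered helper `helper_signConstantOnLeaf` of line `cross-cap-laurent`, crux
`GromovRecognitionRelEnd`, item stmt-SmoothPoincare4-11009)

For a continuous two-chart pair `(u, v)` (`v z = u z⁻¹` off `0`) with a normal witness `(N, π)`
(`IsNormalWitness N π u v`: `N ⊇ pairImage u v` open, `π` a smooth submersion on `N` cutting out the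
image) whose kernels `ker dπ_y`, `y ∈ N`, are `JX`-invariant, the orientation sign
`sign (Im (dπ_y (JX_y ξ)))` (`dπ_y ξ = 1`; independent of `ξ` and non-zero by
`helper_orientationSign_basic`) is the same at any two points of `pairImage u v`.

Proof.  By `helper_orientationSign_locallyConstant` the sign is locally constant on `N`: every
`y₀ ∈ N` has an open `O y₀ ∋ y₀` on which (inside `N`) the sign is that of `y₀`.  The unions `U₊`,
`U₋` of the `O y₀` over the `+` points resp. the `-` points of `N` are open, cover `N`, and a point
of `N ∩ U₊` is `+`, a point of `N ∩ U₋` is `-`.  The image `pairImage u v = range u ∪ {v 0}` is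
preconnected (`range u` is connected and `v 0 = lim_{z → 0} u z⁻¹` lies in its closure), so it
cannot meet both `U₊` and `U₋`.
-/

noncomputable section

open scoped Manifold ContDiff Topology
open Set Function Filter Literature.Geometry.Symplectic

-- the prescribed namespace `Summit.<P>.<Sub>.…` duplicates `SmoothPoincare4` (P = Sub)
set_option linter.dupNamespace false

namespace Summit.SmoothPoincare4.SmoothPoincare4.Theorems.GromovRecognitionRelEnd.CrossCapLaurent

/-- The image `range u ∪ {v 0}` of a continuous two-chart pair (`v z = u z⁻¹` off `0`) is
preconnected: `range u` is connected and `v 0 = lim_{z → 0, z ≠ 0} u z⁻¹` lies in its closure. -/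
theorem sgnLeaf_isPreconnected_pairImage {X : Type} [TopologicalSpace X] {u v : ℂ → X}
    (hu : Continuous u) (hv : Continuous v) (hc : ∀ z : ℂ, z ≠ 0 → v z = u z⁻¹) :
    IsPreconnected (pairImage u v) := by
  rw [pairImage_eq]
  refine (isPreconnected_range hu).subset_closure subset_union_left
    (union_subset subset_closure ?_)
  rw [singleton_subset_iff]
  have ht : Tendsto v (𝓝[≠] (0 : ℂ)) (𝓝 (v 0)) := hv.continuousWithinAt
  refine mem_closure_of_tendsto ht (eventually_nhdsWithin_of_forall fun z hz => ?_)
  exact ⟨z⁻¹, (hc z hz).symm⟩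

/-- J12: CONSTANCY of the orientation sign ALONG AN EMBEDDED SPHERE: for a normal witness `(N, π)`
of the two-chart sphere `(u, v)` whose kernels are `JX`-invariant on `N`, the orientation sign of
`π` is the same at all points of the (connected) image `pairImage u v`. -/
theorem helper_signConstantOnLeaf : ∀ (X : Type) [TopologicalSpace X] [T2Space X]
    [SecondCountableTopology X] [ChartedSpace (EuclideanSpace ℝ (Fin 4)) X] [IsManifold (𝓡 4) ∞ X]
    (JX : AlmostComplexStructure (𝓡 4) ∞ X) (u v : ℂ → X) (N : Set X) (π : X → ℂ),
    ContMDiff 𝓘(ℝ, ℂ) (𝓡 4) ∞ u → ContMDiff 𝓘(ℝ, ℂ) (𝓡 4) ∞ v → (∀ z : ℂ, z ≠ 0 → v z = u z⁻¹) →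
    IsNormalWitness N π u v →
    (∀ y ∈ N, ∀ ξ : TangentSpace (𝓡 4) y, mfderiv (𝓡 4) 𝓘(ℝ, ℂ) π y ξ = 0 →
      mfderiv (𝓡 4) 𝓘(ℝ, ℂ) π y (JX y ξ) = 0) →
    ∀ y ∈ pairImage u v, ∀ y' ∈ pairImage u v,
      ∀ (ξ : TangentSpace (𝓡 4) y) (ξ' : TangentSpace (𝓡 4) y'),
        (show ℂ from mfderiv (𝓡 4) 𝓘(ℝ, ℂ) π y ξ) = 1 →
        (show ℂ from mfderiv (𝓡 4) 𝓘(ℝ, ℂ) π y' ξ') = 1 →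
        (0 < (show ℂ from mfderiv (𝓡 4) 𝓘(ℝ, ℂ) π y (JX y ξ)).im ↔
          0 < (show ℂ from mfderiv (𝓡 4) 𝓘(ℝ, ℂ) π y' (JX y' ξ')).im) := by
  intro X _ _ _ _ _ JX u v N π hu hv hc hW hker
  have hN : IsOpen N := hW.isOpen
  have hsub : pairImage u v ⊆ N := by
    rw [pairImage_eq]
    exact hW.image_subset
  -- the predicate "the orientation sign at `y` is `+`" (for every preimage of `1`)
  set pos : X → Prop := fun y => ∀ ξ : TangentSpace (𝓡 4) y,
    (show ℂ from mfderiv (𝓡 4) 𝓘(ℝ, ℂ) π y ξ) = 1 →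
      0 < (show ℂ from mfderiv (𝓡 4) 𝓘(ℝ, ℂ) π y (JX y ξ)).im
  -- at `y ∈ N` it can be tested on any single preimage of `1`
  have hpos : ∀ y ∈ N, ∀ ξ : TangentSpace (𝓡 4) y, (show ℂ from mfderiv (𝓡 4) 𝓘(ℝ, ℂ) π y ξ) = 1 →
      (pos y ↔ 0 < (show ℂ from mfderiv (𝓡 4) 𝓘(ℝ, ℂ) π y (JX y ξ)).im) := by
    intro y hy ξ hξ
    refine ⟨fun h => h ξ hξ, fun h ξ' hξ' => ?_⟩
    have e := (helper_orientationSign_basic (mfderiv (𝓡 4) 𝓘(ℝ, ℂ) π y) (JX y) ξ' ξ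
      (JX.map_map y) (hW.submersive y hy) (hker y hy) hξ' hξ).1
    exact lt_of_lt_of_eq h (congrArg Complex.im e.symm)
  -- J3: local constancy on `N`
  have hloc := helper_orientationSign_locallyConstant X JX π N hN hW.smooth hW.submersive hker
  choose! O hO using hloc
  have htrans : ∀ y₀ ∈ N, ∀ y ∈ O y₀ ∩ N, (pos y₀ ↔ pos y) := by
    intro y₀ hy₀ y hy
    obtain ⟨ξ₀, hξ₀⟩ := hW.submersive y₀ hy₀ (1 : ℂ)
    obtain ⟨ξ, hξ⟩ := hW.submersive y hy.2 (1 : ℂ)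
    exact (hpos y₀ hy₀ ξ₀ hξ₀).trans
      (((hO y₀ hy₀).2.2 y hy ξ₀ ξ hξ₀ hξ).trans (hpos y hy.2 ξ hξ).symm)
  -- the open sets swept by the neighbourhoods of the `+` points and of the `-` points of `N`
  set Up : Set X := ⋃ y₀ ∈ {y₀ | y₀ ∈ N ∧ pos y₀}, O y₀
  set Um : Set X := ⋃ y₀ ∈ {y₀ | y₀ ∈ N ∧ ¬ pos y₀}, O y₀
  have hUp : IsOpen Up := isOpen_biUnion fun y₀ hy₀ => (hO y₀ hy₀.1).1
  have hUm : IsOpen Um := isOpen_biUnion fun y₀ hy₀ => (hO y₀ hy₀.1).1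
  have hcover : N ⊆ Up ∪ Um := by
    intro y hy
    by_cases h : pos y
    · exact Or.inl (mem_biUnion (show y ∈ {y₀ | y₀ ∈ N ∧ pos y₀} from ⟨hy, h⟩) (hO y hy).2.1)
    · exact Or.inr (mem_biUnion (show y ∈ {y₀ | y₀ ∈ N ∧ ¬ pos y₀} from ⟨hy, h⟩) (hO y hy).2.1)
  have hUp_pos : ∀ y ∈ N, y ∈ Up → pos y := by
    intro y hy hyU
    obtain ⟨y₀, hy₀, hyO⟩ := mem_iUnion₂.mp hyU
    exact (htrans y₀ hy₀.1 y ⟨hyO, hy⟩).mp hy₀.2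
  have hUm_neg : ∀ y ∈ N, y ∈ Um → ¬ pos y := by
    intro y hy hyU
    obtain ⟨y₀, hy₀, hyO⟩ := mem_iUnion₂.mp hyU
    exact fun h => hy₀.2 ((htrans y₀ hy₀.1 y ⟨hyO, hy⟩).mpr h)
  -- the image is preconnected, hence inside one of the two classes
  have hpc : IsPreconnected (pairImage u v) :=
    sgnLeaf_isPreconnected_pairImage hu.continuous hv.continuous hc
  have hconst : ∀ y ∈ pairImage u v, ∀ y' ∈ pairImage u v, pos y → pos y' := by
    intro y hy y' hy' h
    by_contra h'
    have hyU : y ∈ Up :=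
      mem_biUnion (show y ∈ {y₀ | y₀ ∈ N ∧ pos y₀} from ⟨hsub hy, h⟩) (hO y (hsub hy)).2.1
    have hy'U : y' ∈ Um :=
      mem_biUnion (show y' ∈ {y₀ | y₀ ∈ N ∧ ¬ pos y₀} from ⟨hsub hy', h'⟩) (hO y' (hsub hy')).2.1
    obtain ⟨z, hz, hzp, hzm⟩ :=
      hpc Up Um hUp hUm (hsub.trans hcover) ⟨y, hy, hyU⟩ ⟨y', hy', hy'U⟩
    exact hUm_neg z (hsub hz) hzm (hUp_pos z (hsub hz) hzp)
  intro y hy y' hy' ξ ξ' hξ hξ'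
  exact ((hpos y (hsub hy) ξ hξ).symm.trans ⟨hconst y hy y' hy', hconst y' hy' y hy⟩).trans
    (hpos y' (hsub hy') ξ' hξ')

end Summit.SmoothPoincare4.SmoothPoincare4.Theorems.GromovRecognitionRelEnd.CrossCapLaurent

end
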